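/-
Copyright (c) 2026 the pub-hodgecm-mathlib formalisation cell (harness21).  Prover seat hodgecm-mathlib-K2E5-p08 (g2), Track B «K2-LIT» ∕ h413,
engine E5 «TamagawaUnitary», unit G (ZETA), deal BATCH #8 (c) — ARCH HALF, part 1: `D_h ≅ ℍ[L⁺, θ, −b/a]` in a diagonal frame `ᵗP̄ h P = diag(a, b)`,
hence THE REAL PLACES WHERE `D_h` IS RAMIFIED ARE EXACTLY THE PLACES WHERE `h` IS DEFINITE (`w(a) · w(b) > 0`).  2026-09-04.
-/
import Summits.HodgeConjecture.HodgeConjecture.Theorems.K2E5QuatLocalNrdSurjective          -- ★ (p855545, this seat): `conj_mem_quatModel`, `modelElt_mem_quatModel_diagonal` (generic)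
import Summits.HodgeConjecture.HodgeConjecture.Theorems.K2E5QuatZetaDefs                    -- ★ #3g (p16): `quatRatSubalgebra`, `mem_quatRatSubalgebra_iff`, `isQuaternionAlgebra_…`, `finrank_…`
import Literature.NumberTheory.Rogawski1990.UnitaryTwoVariableQuaternionDictionaryCM        -- ★ `isSplitAtInfinite_iff_embedding_pos` (`ℍ[F,d,ξ]` at a real place with `w(d) < 0`)
import Literature.NumberTheory.Automorphic.QuaternionRamificationParity                     -- ★ `isSplitAtInfinite_congr`
import Literature.NumberTheory.Automorphic.QuaternionAlgebraSplitting                       -- ★ `QuaternionAlgebra.isQuaternionAlgebra_holds`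
import Literature.NumberTheory.Automorphic.QuadraticHeckeCharacterCM                        -- ★ `cmQuadraticGenerator_spec`, `embedding_cmQuadraticGenerator_lt_zero'`, `not_isSquare_…`
import Mathlib.Algebra.QuaternionBasis                                                      -- `QuaternionAlgebra.Basis.liftHom`
import HarnessLib

/-!
# K2 ∕ E5 «TamagawaUnitary», unit G (ZETA), deal BATCH #8 (c), ARCH HALF part 1 — `K2E5QuatRamifiedRealPlaces`:
# `D_h ≅ ℍ[L⁺, θ, −b/a]` for a diagonal frame `ᵗP̄ h P = diag(a, b)`, and
# **`D_h` is ramified (not split) at the real place `w` of `L⁺` iff `h` is definite at `w` (`0 < w(a) · w(b)`)**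

Cell `hodgecm-mathlib` (Track B «K2-LIT»), engine E5, item h413 = `stmt-HodgeConjecture-24833`; PROOF lane, helper file
(`--supports stmt-HodgeConjecture-24833 --as helper`; theorems only: no `def`, no instance, no notation, no named fact, no `sorry`).
Part of the ARCH HALF of deal (c) ED. 2 (split with K2E5-p03 (g2), 2026-09-03T23:23:06Z: p03 = the algebra half ★ `K2E5QuatRatReducedNorm`
(`Nrd = det`, Eichler ★ D4 applied); this seat = «`con t ∈ range Nrd ⇒ 0 < w(t)` at every NON-SPLIT real `w`», whose first ingredient is the present
identification of the non-split real places of `D_h`); author K2E5-p08 (g2).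

THE MATHEMATICS ([VignerasLNM800, Ch. I §1 p. 3 (the `{E, e}`-presentation), Ch. III §1 Exemple p. 61 (real ramification)]; [Rogawski1990, §3.8 p. 30];
[PlatonovRapinchuk1994, §2.3]).  `L` CM, `c` = complex conjugation, `K = L⁺`, `L = K(δ)` with `δ̄ = −δ`, `δ² = θ` totally negative (★ `cmQuadraticGenerator_spec`);
`h` hermitian, `P ∈ GL₂(L)`, `a, b ∈ Kˣ` with `ᵗ(c P) h P = diag(a, b)` (such frames exist: ★ B1 `detHermitianDiagonalBasis`); `e = b / a`.
* §1 the elements `i = P · diag(δ, −δ) · P⁻¹`, `j = P · [[0, −e], [1, 0]] · P⁻¹` of `D_h = quatRatSubalgebra L h` (★ generic `modelElt_mem_quatModel_diagonal` + frame transport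
  ★ `conj_mem_quatModel`), with `i² = θ`, `j² = −e`, `ij = −ji` (`quatFrameBasis`, a Mathlib `QuaternionAlgebra.Basis D_h θ 0 (−e)`);
* §2 the induced `ℍ[K, θ, −e] →ₐ[K] D_h` (Mathlib `Basis.liftHom`) is injective (`ℍ[K,θ,−e]` is simple: ★ `isQuaternionAlgebra_holds`, Mathlib `RingHom.injective`) and
  both sides have `dim_K = 4` (Mathlib `QuaternionAlgebra.finrank_eq_four`, ★ `finrank_quatRatSubalgebra`), hence an isomorphism **`ℍ[K, θ, −b/a] ≃ₐ[K] D_h`**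
  (`exists_algEquiv_quaternionAlgebra`);
* §3 transport of splitting (★ `isSplitAtInfinite_congr`) and the real-place criterion for `ℍ[K, d, ξ]` with `w(d) < 0` (★ `isSplitAtInfinite_iff_embedding_pos`: split iff `w(ξ) > 0`):
  **`not_isSplitAtInfinite_iff_definite : ¬ IsSplitAtInfinite D_h w ↔ 0 < w(a) · w(b)`** — `D_h ⊗ K_w` is Hamilton's `ℍ` exactly when `h_w` is definite.

HONEST LABEL: HC_CM is proved only modulo the 7 printed citations (2 remaining named inputs: hLiu418 = stmt-HodgeConjecture-24832,
h413 = stmt-HodgeConjecture-24833) until rung 0 closes; this helper closes no socket and changes no count.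

## References
* [VignerasLNM800] M.-F. Vignéras, *Arithmétique des algèbres de quaternions*, LNM 800 (1980) — Ch. I §1 p. 3; Ch. III §1 Exemple p. 61; Ch. III §4.
* [Rogawski1990] J. D. Rogawski, *Automorphic Representations of Unitary Groups in Three Variables* (1990) — §3.8 p. 30.
* [PlatonovRapinchuk1994] V. Platonov, A. Rapinchuk, *Algebraic Groups and Number Theory* (1994) — §2.3.
-/

set_option autoImplicit false
set_option linter.dupNamespace false

noncomputable section

namespace Summit.HodgeConjecture.HodgeConjecture.Cruxes.H413.K2E5QuatRamifiedRealPlaces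

open NumberField
open Literature.NumberTheory.Automorphic
open Summit.HodgeConjecture.HodgeConjecture.Cruxes.H413.K2E5QuatAdelicMatrixModel
open Summit.HodgeConjecture.HodgeConjecture.Cruxes.H413.K2E5QuatLocalNrdSurjective
open Summit.HodgeConjecture.HodgeConjecture.Cruxes.H413.K2E5QuatZeta
open scoped Matrix MatrixGroups Quaternion

variable (L : Type) [Field L] [NumberField L] [IsCMField L] (Ha : Matrix (Fin 2) (Fin 2) L)

/-! ## §1 The quaternion basis of `D_h` attached to a diagonal frame -/

/-- Conjugating a product: `(P A P⁻¹)(P B P⁻¹) = P (A B) P⁻¹`. [folklore] -/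
theorem conj_mul_conj {R : Type*} [CommRing R] (P : GL (Fin 2) R) (A B : Matrix (Fin 2) (Fin 2) R) :
    ((P : Matrix (Fin 2) (Fin 2) R) * A * ((P⁻¹ : GL (Fin 2) R) : Matrix (Fin 2) (Fin 2) R)) *
        ((P : Matrix (Fin 2) (Fin 2) R) * B * ((P⁻¹ : GL (Fin 2) R) : Matrix (Fin 2) (Fin 2) R)) =
      (P : Matrix (Fin 2) (Fin 2) R) * (A * B) * ((P⁻¹ : GL (Fin 2) R) : Matrix (Fin 2) (Fin 2) R) := by
  have h : ((P⁻¹ : GL (Fin 2) R) : Matrix (Fin 2) (Fin 2) R) * (P : Matrix (Fin 2) (Fin 2) R) = 1 := by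
    rw [← Units.val_mul, inv_mul_cancel, Units.val_one]
  calc _ = (P : Matrix (Fin 2) (Fin 2) R) * A * (((P⁻¹ : GL (Fin 2) R) : Matrix (Fin 2) (Fin 2) R) * (P : Matrix (Fin 2) (Fin 2) R)) * B *
        ((P⁻¹ : GL (Fin 2) R) : Matrix (Fin 2) (Fin 2) R) := by simp only [Matrix.mul_assoc]
    _ = _ := by rw [h, Matrix.mul_one, Matrix.mul_assoc (P : Matrix (Fin 2) (Fin 2) R) A B]

/-- Conjugating a scalar: `P (r · 1) P⁻¹ = r · 1`. [folklore] -/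
theorem conj_smul_one {R : Type*} [CommRing R] (P : GL (Fin 2) R) (r : R) :
    (P : Matrix (Fin 2) (Fin 2) R) * (r • (1 : Matrix (Fin 2) (Fin 2) R)) * ((P⁻¹ : GL (Fin 2) R) : Matrix (Fin 2) (Fin 2) R) =
      r • (1 : Matrix (Fin 2) (Fin 2) R) := by
  rw [Matrix.mul_smul, Matrix.mul_one, Matrix.smul_mul, ← Units.val_mul, mul_inv_cancel, Units.val_one]

/-- **`D_h ≅ ℍ[L⁺, θ, −b/a]`** for a diagonal frame `ᵗ(cP) h P = diag(a, b)` (`a, b ∈ L⁺ˣ`; `L = L⁺(δ)`, `δ̄ = −δ`, `δ² = θ`): an `L⁺`-algebra isomorphism from Mathlib's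
`ℍ[L⁺, θ, −b/a]` onto ★ #3g `quatRatSubalgebra L h`, sending `i ↦ P diag(δ, −δ) P⁻¹`, `j ↦ P [[0, −b/a], [1, 0]] P⁻¹` (the `{E, e}`-presentation of `D_h`).
[cite: VignerasLNM800, Ch. I §1 p. 3] [cite: PlatonovRapinchuk1994, §2.3] -/
theorem exists_algEquiv_quaternionAlgebra (hHa : (Ha.map (cmConjRingHom L)).transpose = Ha) (hdet : Ha.det ≠ 0)
    (P : GL (Fin 2) L) (a b : ↥(maximalRealSubfield L)) (ha : a ≠ 0) (hb : b ≠ 0)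
    (hP : ((P : Matrix (Fin 2) (Fin 2) L).map (cmConjRingHom L))ᵀ * Ha * (P : Matrix (Fin 2) (Fin 2) L) = Matrix.diagonal ![(a : L), (b : L)]) :
    Nonempty (ℍ[↥(maximalRealSubfield L), (cmQuadraticGenerator L : ↥(maximalRealSubfield L)), -(b / a)] ≃ₐ[↥(maximalRealSubfield L)]
      ↥(quatRatSubalgebra L Ha)) := by
  classical
  set c : L →+* L := cmConjRingHom L with hc
  set θ : ↥(maximalRealSubfield L) := (cmQuadraticGenerator L : ↥(maximalRealSubfield L)) with hθdef
  set e : ↥(maximalRealSubfield L) := b / a with hedef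
  obtain ⟨δ, hδ0, hcδ, hδsq⟩ := cmQuadraticGenerator_spec L
  have hcδ' : c δ = -δ := hcδ
  have hδδ : δ * δ = ((θ : ↥(maximalRealSubfield L)) : L) := by rw [← sq, hδsq]; rfl
  have hcc : ∀ x : L, c (c x) = x := fun x => IsCMField.complexConj_apply_apply L x
  have hcK : ∀ k : ↥(maximalRealSubfield L), c (k : L) = (k : L) := fun k => IsCMField.complexConj_apply_eq_self L k
  have haeb : (a : L) * (e : L) = (b : L) := by
    rw [hedef, Subfield.coe_div, mul_div_cancel₀ _ (fun h => ha (Subtype.ext h))]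
  -- the diagonal model and its two generators
  have hP' : ((P : Matrix (Fin 2) (Fin 2) L).map c)ᵀ * Ha * (P : Matrix (Fin 2) (Fin 2) L) = Matrix.diagonal ![(a : L), (a : L) * (e : L)] := by
    rw [haeb]; exact hP
  set i' : Matrix (Fin 2) (Fin 2) L := !![δ, -((e : L) * c 0); 0, c δ] with hi'
  set j' : Matrix (Fin 2) (Fin 2) L := !![0, -((e : L) * c 1); 1, c 0] with hj'
  have hi'D : i' ∈ quatModel c (Matrix.diagonal ![(a : L), (a : L) * (e : L)]) := modelElt_mem_quatModel_diagonal c hcc _ (hcK e) δ 0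
  have hj'D : j' ∈ quatModel c (Matrix.diagonal ![(a : L), (a : L) * (e : L)]) := modelElt_mem_quatModel_diagonal c hcc _ (hcK e) 0 1
  have hi'eq : i' = !![δ, 0; 0, -δ] := by rw [hi', map_zero, mul_zero, neg_zero, hcδ']
  have hj'eq : j' = !![0, -(e : L); 1, 0] := by rw [hj', map_one, mul_one, map_zero]
  -- relations in the diagonal model
  have hii' : i' * i' = ((θ : ↥(maximalRealSubfield L)) : L) • (1 : Matrix (Fin 2) (Fin 2) L) := by
    rw [hi'eq, ← hδδ]
    ext m n
    fin_cases m <;> fin_cases n <;> simp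
  have hjj' : j' * j' = (((-e : ↥(maximalRealSubfield L))) : L) • (1 : Matrix (Fin 2) (Fin 2) L) := by
    rw [hj'eq, Subfield.coe_neg]
    ext m n
    fin_cases m <;> fin_cases n <;> simp
  have hij' : j' * i' = -(i' * j') := by
    rw [hi'eq, hj'eq]
    ext m n
    fin_cases m <;> fin_cases n <;> simp [mul_comm]
  -- transport to `D_h`
  set p : Matrix (Fin 2) (Fin 2) L := (P : Matrix (Fin 2) (Fin 2) L) with hp
  set q : Matrix (Fin 2) (Fin 2) L := ((P⁻¹ : GL (Fin 2) L) : Matrix (Fin 2) (Fin 2) L) with hq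
  have hiD : p * i' * q ∈ quatRatSubalgebra L Ha := (mem_quatRatSubalgebra_iff L Ha _).2 (conj_mem_quatModel c P Ha (by rw [hP']; exact hi'D))
  have hjD : p * j' * q ∈ quatRatSubalgebra L Ha := (mem_quatRatSubalgebra_iff L Ha _).2 (conj_mem_quatModel c P Ha (by rw [hP']; exact hj'D))
  set I : ↥(quatRatSubalgebra L Ha) := ⟨p * i' * q, hiD⟩ with hI
  set J : ↥(quatRatSubalgebra L Ha) := ⟨p * j' * q, hjD⟩ with hJ
  have hsmul : ∀ (k : ↥(maximalRealSubfield L)) (X : ↥(quatRatSubalgebra L Ha)),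
      ((k • X : ↥(quatRatSubalgebra L Ha)) : Matrix (Fin 2) (Fin 2) L) = (k : L) • (X : Matrix (Fin 2) (Fin 2) L) := fun k X => rfl
  have hII : I * I = θ • (1 : ↥(quatRatSubalgebra L Ha)) + (0 : ↥(maximalRealSubfield L)) • I := by
    rw [zero_smul, add_zero]
    apply Subtype.ext
    rw [hsmul, Subalgebra.coe_mul, Subalgebra.coe_one, hI, Subtype.coe_mk, conj_mul_conj, hii', conj_smul_one]
  have hJJ : J * J = (-e) • (1 : ↥(quatRatSubalgebra L Ha)) := by
    apply Subtype.ext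
    rw [hsmul, Subalgebra.coe_mul, Subalgebra.coe_one, hJ, Subtype.coe_mk, conj_mul_conj, hjj', conj_smul_one]
  have hJI : J * I = (0 : ↥(maximalRealSubfield L)) • J - I * J := by
    rw [zero_smul, zero_sub]
    apply Subtype.ext
    rw [Subalgebra.coe_mul, Subalgebra.coe_neg, Subalgebra.coe_mul, hI, hJ, Subtype.coe_mk, Subtype.coe_mk, conj_mul_conj, conj_mul_conj, hij',
      Matrix.mul_neg, Matrix.neg_mul]
  -- the lift is injective (source simple) and the dimensions agree
  have hθ0 : θ ≠ 0 := fun h => not_isSquare_cmQuadraticGenerator L (by rw [← hθdef, h]; exact IsSquare.zero)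
  have he0 : -e ≠ 0 := neg_ne_zero.2 (div_ne_zero hb ha)
  clear_value θ e
  subst hedef
  let B : QuaternionAlgebra.Basis ↥(quatRatSubalgebra L Ha) θ (0 : ↥(maximalRealSubfield L)) (-(b / a)) :=
    { i := I, j := J, k := I * J, i_mul_i := hII, j_mul_j := hJJ, i_mul_j := rfl, j_mul_i := hJI }
  haveI : IsQuaternionAlgebra ↥(maximalRealSubfield L) ℍ[↥(maximalRealSubfield L), θ, -(b / a)] := QuaternionAlgebra.isQuaternionAlgebra_holds hθ0 he0
  haveI : IsSimpleRing ℍ[↥(maximalRealSubfield L), θ, -(b / a)] := IsQuaternionAlgebra.isSimpleRing' ↥(maximalRealSubfield L) _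
  haveI hQ := isQuaternionAlgebra_quatRatSubalgebra L Ha hHa hdet
  have hinj : Function.Injective B.liftHom := RingHom.injective B.liftHom.toRingHom
  have hdim : Module.finrank ↥(maximalRealSubfield L) ℍ[↥(maximalRealSubfield L), θ, -(b / a)] =
      Module.finrank ↥(maximalRealSubfield L) ↥(quatRatSubalgebra L Ha) := by
    rw [QuaternionAlgebra.finrank_eq_four, finrank_quatRatSubalgebra L Ha hHa hdet]
  have hsurj : Function.Surjective B.liftHom :=
    (LinearMap.injective_iff_surjective_of_finrank_eq_finrank hdim (f := B.liftHom.toLinearMap)).1 hinj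
  subst hθdef
  exact ⟨AlgEquiv.ofBijective B.liftHom ⟨hinj, hsurj⟩⟩

/-! ## §2 Real ramification of `D_h` = definiteness of `h` -/

/-- **`D_h` IS RAMIFIED AT THE REAL PLACE `w` OF `L⁺` IFF `h` IS DEFINITE AT `w`**: for a diagonal frame `ᵗ(cP) h P = diag(a, b)`, `¬ IsSplitAtInfinite D_h w ↔ 0 < w(a)·w(b)`
(`D_h ≅ ℍ[L⁺, θ, −b/a]`, §1; ★ `isSplitAtInfinite_iff_embedding_pos`: at a real `w` with `w(θ) < 0`, `ℍ[L⁺, θ, ξ]` splits iff `w(ξ) > 0`; here `ξ = −b/a`).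
[cite: VignerasLNM800, Ch. III §1 Exemple p. 61] [cite: Rogawski1990, §3.8 p. 30] -/
theorem not_isSplitAtInfinite_iff_definite (hHa : (Ha.map (cmConjRingHom L)).transpose = Ha) (hdet : Ha.det ≠ 0)
    (P : GL (Fin 2) L) (a b : ↥(maximalRealSubfield L)) (ha : a ≠ 0) (hb : b ≠ 0)
    (hP : ((P : Matrix (Fin 2) (Fin 2) L).map (cmConjRingHom L))ᵀ * Ha * (P : Matrix (Fin 2) (Fin 2) L) = Matrix.diagonal ![(a : L), (b : L)])
    (w : InfinitePlace ↥(maximalRealSubfield L)) (hw : w.IsReal) :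
    ¬ IsSplitAtInfinite ↥(quatRatSubalgebra L Ha) w ↔
      0 < InfinitePlace.embedding_of_isReal hw a * InfinitePlace.embedding_of_isReal hw b := by
  obtain ⟨eqv⟩ := exists_algEquiv_quaternionAlgebra L Ha hHa hdet P a b ha hb hP
  have hθ0 : (cmQuadraticGenerator L : ↥(maximalRealSubfield L)) ≠ 0 := fun h =>
    not_isSquare_cmQuadraticGenerator L (by rw [h]; exact IsSquare.zero)
  have hξ : -(b / a) ≠ 0 := neg_ne_zero.2 (div_ne_zero hb ha)
  rw [← isSplitAtInfinite_congr (↥(maximalRealSubfield L)) _ eqv w,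
    Literature.NumberTheory.Rogawski1990.UnitaryQuaternion.isSplitAtInfinite_iff_embedding_pos hθ0 hξ hw (embedding_cmQuadraticGenerator_lt_zero' L w hw),
    map_neg, map_div₀, not_lt]
  have ha' : InfinitePlace.embedding_of_isReal hw a ≠ 0 := (map_ne_zero _).2 ha
  have hb' : InfinitePlace.embedding_of_isReal hw b ≠ 0 := (map_ne_zero _).2 hb
  constructor
  · intro h
    have h' : InfinitePlace.embedding_of_isReal hw b / InfinitePlace.embedding_of_isReal hw a > 0 := by
      rcases (neg_nonpos.1 h).lt_or_eq with hlt | heq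
      · exact hlt
      · exact absurd heq.symm (div_ne_zero hb' ha')
    have := mul_pos h' (mul_self_pos.2 ha')
    rw [div_mul_eq_mul_div, mul_div_assoc, mul_self_div_self] at this
    linarith [mul_comm (InfinitePlace.embedding_of_isReal hw b) (InfinitePlace.embedding_of_isReal hw a)]
  · intro h
    have h' : 0 < InfinitePlace.embedding_of_isReal hw b / InfinitePlace.embedding_of_isReal hw a := by
      have := div_pos h (mul_self_pos.2 ha')
      rwa [mul_comm, mul_div_mul_right _ _ ha'] at this
    exact neg_nonpos.2 h'.le

end Summit.HodgeConjecture.HodgeConjecture.Cruxes.H413.K2E5QuatRamifiedRealPlaces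

end
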